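import Literature.MathematicalPhysics.QuantumFieldTheory.LatticeSiteRPMechanism
import HarnessLib

/-!
# Lattice reflection positivity with a shared block and a positive kernel on the shared block

Theorem-only companion to `LatticeSiteRPMechanism` (namespace
`Literature.MathematicalPhysics.QuantumFieldTheory.LatticeRP`; same objects: the product
probability measure `μ = piMeasure μ₀` on `Ω = ι → G`, the coordinate splice `splice C (U, Y)`,
a measure-preserving reflection `Θ` fixing the shared block `M`). The parent file proves the
positivity of `∫∫ Φ(splice C (U, Y)) conj Φ(Θ U)` for ONE observable `Φ`. When the variables
living IN the reflection plane are not only classical coordinates (the block `M`, on which one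
conditions) but also FERMIONIC (the quark fields of the reflection time-slice in the
site-reflection positivity of Wilson fermions, Montvay–Münster 1994 §4.2.3 (4.108), Lüscher 1977),
integrating them out does not produce `Φ · conj Φ` but a HERMITIAN FORM
`Σ_{I,J} Φ_I(z) conj Φ_J(Θ U) P_{IJ}(U)` whose kernel `P(U)` depends only on the shared block and
is positive semidefinite for every `U` (the compound matrices of `B⁻¹`, Montvay–Münster (4.109)).
This file proves the corresponding generalisation of the mechanism:

* `integral_splice_mul_conj_comp_of_shared₂` — the core identity for TWO observables and a
  shared-block weight `p`:
  `∫∫ Φ₁(splice C (U, Y)) conj Φ₂(Θ U) p(U) dμ dμ = ∫ χ₁ conj χ₂ p dμ`,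
  `χ_k(V) = ∫ Φ_k(splice (P ∪ C) (V, W)) dμ(W)`;
* `integral_sum_splice_mul_conj_kernel_nonneg` — for a finite family `Φ_I` and a bounded
  measurable kernel `P_{IJ}` depending only on `M` with `Σ x_I conj x_J P_{IJ}(V) ≥ 0` pointwise,
  `0 ≤ ∫∫ Σ_{I,J} Φ_I(z) conj Φ_J(Θ U) P_{IJ}(U)`;
* `integral_sum_mul_conj_kernel_mul_exp_nonneg` — the same multiplied by the Gram factor
  `exp(Σᵢ aᵢ(z) conj aᵢ(Θ U))` of the crossing couplings (via the parent's
  `integral_mul_mul_exp_sum_nonneg`).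

References: K. Osterwalder, E. Seiler, Ann. Phys. 110 (1978) 440, §2; J. Fröhlich, R. Israel,
E. Lieb, B. Simon, Comm. Math. Phys. 62 (1978) 1, Thm. 2.1; I. Montvay, G. Münster, *Quantum
Fields on a Lattice* (CUP 1994) §4.2.3 (4.107)–(4.110). All statements here are proved. [folklore]
-/

open MeasureTheory ProbabilityTheory Finset Filter
open scoped ComplexOrder ENNReal NNReal ComplexConjugate

namespace Literature.MathematicalPhysics.QuantumFieldTheory.LatticeRP

noncomputable section

variable {ι : Type*} [Fintype ι] [DecidableEq ι] {G : Type*} [MeasurableSpace G]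
variable (μ₀ : Measure G) [IsProbabilityMeasure μ₀]

variable (M P C : Finset ι) (Θ : (ι → G) → (ι → G))

/-- **Core identity with a shared block, two observables and a shared-block weight.** Let `Θ`
preserve the product measure, fix the `M`-coordinates, and let the `P ∪ C`-coordinates of `Θ U`
depend only on `U` off `P`, with `M` disjoint from `P` and from `C`. Then for bounded measurable
`Φ₁, Φ₂` depending only on `P ∪ C ∪ M` and `p` depending only on `M`,
`∫∫ Φ₁(splice C (U, Y)) conj Φ₂(Θ U) p(U) dμ(U) dμ(Y) = ∫ χ₁ conj χ₂ p dμ`,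
`χ_k(V) = ∫ Φ_k(splice (P ∪ C) (V, W)) dμ(W)`. [folklore] -/
theorem integral_splice_mul_conj_comp_of_shared₂
    (hΘ : MeasurePreserving Θ (piMeasure μ₀) (piMeasure μ₀))
    (hΘM : ∀ U, ∀ i ∈ M, Θ U i = U i)
    (hΘdep : ∀ e ∈ P ∪ C, DependsOn (fun U => Θ U e) ((Pᶜ : Finset ι) : Set ι))
    (hMP : Disjoint M P) (hMC : Disjoint M C)
    {Φ₁ Φ₂ p : (ι → G) → ℂ} (hΦ₁m : Measurable Φ₁) (hΦ₂m : Measurable Φ₂) (hpm : Measurable p)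
    {K : ℝ} (hΦ₁b : ∀ U, ‖Φ₁ U‖ ≤ K) (hΦ₂b : ∀ U, ‖Φ₂ U‖ ≤ K) (hpb : ∀ U, ‖p U‖ ≤ K)
    (hΦ₁dep : DependsOn Φ₁ ((P ∪ C ∪ M : Finset ι) : Set ι))
    (hΦ₂dep : DependsOn Φ₂ ((P ∪ C ∪ M : Finset ι) : Set ι))
    (hpdep : DependsOn p ((M : Finset ι) : Set ι)) :
    ∫ q, Φ₁ (splice C q) * conj (Φ₂ (Θ q.1)) * p q.1 ∂((piMeasure μ₀).prod (piMeasure μ₀)) =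
      ∫ V, (∫ W, Φ₁ (splice (P ∪ C) (V, W)) ∂(piMeasure μ₀)) *
        conj (∫ W, Φ₂ (splice (P ∪ C) (V, W)) ∂(piMeasure μ₀)) * p V ∂(piMeasure μ₀) := by
  set μ : Measure (ι → G) := piMeasure μ₀ with hμ
  have hΘm : Measurable Θ := hΘ.measurable
  have hconj : Measurable (starRingEnd ℂ : ℂ → ℂ) := Complex.continuous_conj.measurable
  obtain ⟨U₀⟩ : Nonempty (ι → G) := by
    have : Nonempty G := MeasureTheory.nonempty_of_isProbabilityMeasure μ₀
    infer_instance
  have hK : 0 ≤ K := (norm_nonneg _).trans (hpb U₀)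
  -- the players
  set ψ : (ι → G) → (ι → G) → ℂ := fun Y V => ∫ W, Φ₁ (splice C (splice P (V, W), Y)) ∂μ with hψ
  set χ₁ : (ι → G) → ℂ := fun V => ∫ W, Φ₁ (splice (P ∪ C) (V, W)) ∂μ with hχ₁
  set χ₂ : (ι → G) → ℂ := fun V => ∫ W, Φ₂ (splice (P ∪ C) (V, W)) ∂μ with hχ₂
  -- measurability
  have hm3 : Measurable fun q : ((ι → G) × (ι → G)) × (ι → G) =>
      Φ₁ (splice C (splice P (q.1.2, q.2), q.1.1)) :=
    hΦ₁m.comp ((measurable_splice C).comp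
      (((measurable_splice P).comp ((measurable_snd.comp measurable_fst).prodMk measurable_snd)).prodMk
        (measurable_fst.comp measurable_fst)))
  have hψm2 : Measurable fun q : (ι → G) × (ι → G) => ψ q.1 q.2 :=
    measurable_integral_parametric hm3
  have hψm : ∀ Y, Measurable (ψ Y) := fun Y => hψm2.comp (measurable_const.prodMk measurable_id)
  have hχ₁m : Measurable χ₁ :=
    measurable_integral_parametric (hΦ₁m.comp (measurable_splice (P ∪ C)))
  have hχ₂m : Measurable χ₂ :=
    measurable_integral_parametric (hΦ₂m.comp (measurable_splice (P ∪ C)))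
  -- bounds
  have hψb : ∀ Y V, ‖ψ Y V‖ ≤ K := fun Y V => norm_integral_le_of_norm_le_prob fun W => hΦ₁b _
  have hχ₂b : ∀ V, ‖χ₂ V‖ ≤ K := fun V => norm_integral_le_of_norm_le_prob fun W => hΦ₂b _
  -- dependence
  have hψdep : ∀ Y, DependsOn (ψ Y) ((M : Finset ι) : Set ι) := by
    intro Y V V' hVV'
    simp only [hψ]
    refine integral_congr_ae (ae_of_all _ fun W => ?_)
    apply dependsOn_splice_left_of_shared P C M hΦ₁dep Y
    intro i hi
    simp only [splice_apply]
    split_ifs with hP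
    · rfl
    · have hiM : i ∈ M := by
        rcases Finset.mem_union.1 (Finset.mem_coe.1 hi) with h | h
        · exact absurd h hP
        · exact h
      exact hVV' i (Finset.mem_coe.2 hiM)
  have hpP : DependsOn p ((Pᶜ : Finset ι) : Set ι) := fun U V hUV =>
    hpdep fun i hi => hUV i (Finset.mem_coe.2 (Finset.mem_compl.2
      (Finset.disjoint_left.1 hMP (Finset.mem_coe.1 hi))))
  have hΦΘdep : DependsOn (fun U => conj (Φ₂ (Θ U))) ((Pᶜ : Finset ι) : Set ι) := fun U V hUV =>
    congrArg conj (dependsOn_comp_of_shared P C M Θ hΦ₂dep hΘM hΘdep hMP hUV)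
  have hpΘ : ∀ V, p (Θ V) = p V := fun V => hpdep fun i hi => hΘM V i (Finset.mem_coe.1 hi)
  -- Step A: for fixed `Y`, integrate out the `P`-coordinates of the positive factor
  have stepA : ∀ Y, ∫ U, Φ₁ (splice C (U, Y)) * conj (Φ₂ (Θ U)) * p U ∂μ =
      ∫ V, conj (Φ₂ (Θ V)) * p V * ψ Y V ∂μ := by
    intro Y
    have hFm : Measurable fun U => Φ₁ (splice C (U, Y)) * conj (Φ₂ (Θ U)) * p U :=
      ((hΦ₁m.comp ((measurable_splice C).comp (measurable_id.prodMk measurable_const))).mul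
        (hconj.comp (hΦ₂m.comp hΘm))).mul hpm
    rw [← integral_comp_eq_of_measurePreserving (measurePreserving_splice μ₀ P) hFm]
    have hGi : Integrable (fun q : (ι → G) × (ι → G) =>
        Φ₁ (splice C (splice P q, Y)) * conj (Φ₂ (Θ (splice P q))) * p (splice P q)) (μ.prod μ) :=
      integrable_of_norm_le (hFm.comp (measurable_splice P)) (K := K * K * K) fun q => by
        rw [norm_mul, norm_mul, Complex.norm_conj]
        exact mul_le_mul (mul_le_mul (hΦ₁b _) (hΦ₂b _) (norm_nonneg _) hK) (hpb _) (norm_nonneg _)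
          (mul_nonneg hK hK)
    rw [integral_prod _ hGi]
    refine integral_congr_ae (ae_of_all _ fun V => ?_)
    have hΘV : ∀ W, conj (Φ₂ (Θ (splice P (V, W)))) = conj (Φ₂ (Θ V)) := fun W =>
      apply_splice_of_dependsOn_compl hΦΘdep V W
    have hpV : ∀ W, p (splice P (V, W)) = p V := fun W => apply_splice_of_dependsOn_compl hpP V W
    simp only
    simp_rw [hΘV, hpV]
    simp_rw [mul_assoc, mul_comm (Φ₁ _) _]
    rw [integral_const_mul, mul_assoc]
  -- Step B: `Θ`-invariance moves the reflection onto the other factor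
  have stepB : ∀ Y, ∫ V, conj (Φ₂ (Θ V)) * p V * ψ Y V ∂μ = ∫ V, conj (Φ₂ V) * p V * ψ Y V ∂μ := by
    intro Y
    have h1 : ∀ V, ψ Y V = ψ Y (Θ V) := fun V => hψdep Y fun i hi => (hΘM V i (Finset.mem_coe.1 hi)).symm
    calc ∫ V, conj (Φ₂ (Θ V)) * p V * ψ Y V ∂μ = ∫ V, conj (Φ₂ (Θ V)) * p (Θ V) * ψ Y (Θ V) ∂μ := by
          simp_rw [← h1, hpΘ]
      _ = ∫ V, conj (Φ₂ V) * p V * ψ Y V ∂μ :=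
          integral_comp_eq_of_measurePreserving hΘ (((hconj.comp hΦ₂m).mul hpm).mul (hψm Y))
  -- Step C: integrate out the `P ∪ C`-coordinates of the reflected factor
  have stepC : ∀ Y, ∫ V, conj (Φ₂ V) * p V * ψ Y V ∂μ = ∫ V, ψ Y V * (conj (χ₂ V) * p V) ∂μ := by
    intro Y
    have hFm : Measurable fun V => conj (Φ₂ V) * p V * ψ Y V :=
      ((hconj.comp hΦ₂m).mul hpm).mul (hψm Y)
    rw [← integral_comp_eq_of_measurePreserving (measurePreserving_splice μ₀ (P ∪ C)) hFm]
    have hGi : Integrable (fun q : (ι → G) × (ι → G) =>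
        conj (Φ₂ (splice (P ∪ C) q)) * p (splice (P ∪ C) q) * ψ Y (splice (P ∪ C) q)) (μ.prod μ) :=
      integrable_of_norm_le (hFm.comp (measurable_splice (P ∪ C))) (K := K * K * K) fun q => by
        rw [norm_mul, norm_mul, Complex.norm_conj]
        exact mul_le_mul (mul_le_mul (hΦ₂b _) (hpb _) (norm_nonneg _) hK) (hψb _ _) (norm_nonneg _)
          (mul_nonneg hK hK)
    rw [integral_prod _ hGi]
    refine integral_congr_ae (ae_of_all _ fun V => ?_)
    have hMPC : Disjoint M (P ∪ C) := Finset.disjoint_union_right.2 ⟨hMP, hMC⟩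
    have hψV : ∀ W, ψ Y (splice (P ∪ C) (V, W)) = ψ Y V := fun W =>
      apply_splice_of_dependsOn_of_disjoint (hψdep Y) hMPC V W
    have hpV : ∀ W, p (splice (P ∪ C) (V, W)) = p V := fun W =>
      apply_splice_of_dependsOn_of_disjoint hpdep hMPC V W
    simp only
    simp_rw [hψV, hpV]
    rw [integral_mul_const, integral_mul_const, ← integral_conj]
    ring
  -- Step D: the `Y`-average of `ψ Y` is `χ₁`
  have stepD : ∀ V, ∫ Y, ψ Y V ∂μ = χ₁ V := by
    intro V
    simp only [hψ, hχ₁]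
    simp_rw [splice_splice_eq_splice_union P C V]
    have hFm : Measurable fun Z => Φ₁ (splice (P ∪ C) (V, Z)) :=
      hΦ₁m.comp ((measurable_splice (P ∪ C)).comp (measurable_const.prodMk measurable_id))
    have hGi : Integrable (fun q : (ι → G) × (ι → G) =>
        Φ₁ (splice (P ∪ C) (V, splice C (q.2, q.1)))) (μ.prod μ) :=
      integrable_of_norm_le (hFm.comp ((measurable_splice C).comp measurable_swap)) fun q => hΦ₁b _
    rw [← integral_prod _ hGi]
    have hswap : MeasurePreserving (fun q : (ι → G) × (ι → G) => splice C (q.2, q.1))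
        (μ.prod μ) μ :=
      (measurePreserving_splice μ₀ C).comp (Measure.measurePreserving_swap (μ := μ) (ν := μ))
    exact integral_comp_eq_of_measurePreserving hswap hFm
  -- assemble: Fubini in `(U, Y)`, then in `(Y, V)`
  have hJi : Integrable (fun q : (ι → G) × (ι → G) =>
      Φ₁ (splice C q) * conj (Φ₂ (Θ q.1)) * p q.1) (μ.prod μ) :=
    integrable_of_norm_le (((hΦ₁m.comp (measurable_splice C)).mul
      (hconj.comp (hΦ₂m.comp (hΘm.comp measurable_fst)))).mul (hpm.comp measurable_fst))
      (K := K * K * K) fun q => by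
        rw [norm_mul, norm_mul, Complex.norm_conj]
        exact mul_le_mul (mul_le_mul (hΦ₁b _) (hΦ₂b _) (norm_nonneg _) hK) (hpb _) (norm_nonneg _)
          (mul_nonneg hK hK)
  rw [integral_prod_symm _ hJi]
  simp_rw [stepA, stepB, stepC]
  -- swap the `Y`- and `V`-integrals
  have hKi : Integrable (Function.uncurry fun Y V => ψ Y V * (conj (χ₂ V) * p V)) (μ.prod μ) :=
    integrable_of_norm_le (hψm2.mul ((hconj.comp (hχ₂m.comp measurable_snd)).mul
      (hpm.comp measurable_snd))) (K := K * (K * K))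
      fun q => by
        rw [Function.uncurry_apply_pair, norm_mul, norm_mul, Complex.norm_conj]
        exact mul_le_mul (hψb _ _) (mul_le_mul (hχ₂b _) (hpb _) (norm_nonneg _) hK)
          (mul_nonneg (norm_nonneg _) (norm_nonneg _)) hK
  rw [integral_integral_swap hKi]
  refine integral_congr_ae (ae_of_all _ fun V => ?_)
  dsimp only
  rw [integral_mul_const, stepD, mul_assoc]

/-- **Positivity with a positive semidefinite kernel on the shared block.** Under the
hypotheses of the core identity, let `Φ_I` (`I` in a finite set) be bounded measurable,
depending only on `P ∪ C ∪ M`, and let `Pk I J` be a bounded measurable kernel depending only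
on `M` which is positive semidefinite at every configuration:
`0 ≤ Σ_{I,J} x_I conj x_J Pk_{IJ}(V)` for all `x`. Then
`0 ≤ ∫∫ Σ_{I,J} Φ_I(splice C (U,Y)) conj Φ_J(Θ U) Pk_{IJ}(U) dμ(U) dμ(Y)` — it equals
`∫ Σ_{I,J} χ_I conj χ_J Pk_{IJ} dμ ≥ 0`. This is the measure-theoretic content of the
site-reflection positivity of lattice fermions after the fields of the reflection slice have
been integrated out (Montvay–Münster (4.108)–(4.110)). [cite: MontvayMunster1994, §4.2.3 (4.108)–(4.110)] -/
theorem integral_sum_splice_mul_conj_kernel_nonneg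
    (hΘ : MeasurePreserving Θ (piMeasure μ₀) (piMeasure μ₀))
    (hΘM : ∀ U, ∀ i ∈ M, Θ U i = U i)
    (hΘdep : ∀ e ∈ P ∪ C, DependsOn (fun U => Θ U e) ((Pᶜ : Finset ι) : Set ι))
    (hMP : Disjoint M P) (hMC : Disjoint M C)
    {𝓘 : Type*} [Fintype 𝓘] {Φ : 𝓘 → (ι → G) → ℂ} {Pk : 𝓘 → 𝓘 → (ι → G) → ℂ}
    (hΦm : ∀ I, Measurable (Φ I)) (hPm : ∀ I J, Measurable (Pk I J)) {K : ℝ}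
    (hΦb : ∀ I U, ‖Φ I U‖ ≤ K) (hPb : ∀ I J U, ‖Pk I J U‖ ≤ K)
    (hΦdep : ∀ I, DependsOn (Φ I) ((P ∪ C ∪ M : Finset ι) : Set ι))
    (hPdep : ∀ I J, DependsOn (Pk I J) ((M : Finset ι) : Set ι))
    (hPpos : ∀ V (x : 𝓘 → ℂ), 0 ≤ ∑ I, ∑ J, x I * conj (x J) * Pk I J V) :
    0 ≤ ∫ q, ∑ I, ∑ J, Φ I (splice C q) * conj (Φ J (Θ q.1)) * Pk I J q.1
      ∂((piMeasure μ₀).prod (piMeasure μ₀)) := by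
  set μ : Measure (ι → G) := piMeasure μ₀ with hμ
  have hΘm : Measurable Θ := hΘ.measurable
  have hconj : Measurable (starRingEnd ℂ : ℂ → ℂ) := Complex.continuous_conj.measurable
  obtain ⟨U₀⟩ : Nonempty (ι → G) := by
    have : Nonempty G := MeasureTheory.nonempty_of_isProbabilityMeasure μ₀
    infer_instance
  rcases isEmpty_or_nonempty 𝓘 with h𝓘 | ⟨⟨I₀⟩⟩
  · simp
  have hK : 0 ≤ K := (norm_nonneg _).trans (hΦb I₀ U₀)
  set χ : 𝓘 → (ι → G) → ℂ := fun I V => ∫ W, Φ I (splice (P ∪ C) (V, W)) ∂μ with hχ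
  -- termwise integrability, then swap sum and integral
  have hterm : ∀ I J, Integrable (fun q : (ι → G) × (ι → G) =>
      Φ I (splice C q) * conj (Φ J (Θ q.1)) * Pk I J q.1) (μ.prod μ) := fun I J =>
    integrable_of_norm_le ((((hΦm I).comp (measurable_splice C)).mul
      (hconj.comp ((hΦm J).comp (hΘm.comp measurable_fst)))).mul ((hPm I J).comp measurable_fst))
      (K := K * K * K) fun q => by
        rw [norm_mul, norm_mul, Complex.norm_conj]
        exact mul_le_mul (mul_le_mul (hΦb _ _) (hΦb _ _) (norm_nonneg _) hK) (hPb _ _ _)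
          (norm_nonneg _) (mul_nonneg hK hK)
  have hLHS : ∫ q, ∑ I, ∑ J, Φ I (splice C q) * conj (Φ J (Θ q.1)) * Pk I J q.1 ∂(μ.prod μ) =
      ∑ I, ∑ J, ∫ q, Φ I (splice C q) * conj (Φ J (Θ q.1)) * Pk I J q.1 ∂(μ.prod μ) := by
    rw [integral_finsetSum _ fun I _ => integrable_finsetSum _ fun J _ => hterm I J]
    exact Finset.sum_congr rfl fun I _ => integral_finsetSum _ fun J _ => hterm I J
  have hIJ : ∀ I J, ∫ q, Φ I (splice C q) * conj (Φ J (Θ q.1)) * Pk I J q.1 ∂(μ.prod μ) =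
      ∫ V, χ I V * conj (χ J V) * Pk I J V ∂μ := fun I J =>
    integral_splice_mul_conj_comp_of_shared₂ μ₀ M P C Θ hΘ hΘM hΘdep hMP hMC (hΦm I) (hΦm J)
      (hPm I J) (hΦb I) (hΦb J) (hPb I J) (hΦdep I) (hΦdep J) (hPdep I J)
  -- back to one integral of the Hermitian form in `χ`
  have hχm : ∀ I, Measurable (χ I) := fun I =>
    measurable_integral_parametric ((hΦm I).comp (measurable_splice (P ∪ C)))
  have hχb : ∀ I V, ‖χ I V‖ ≤ K := fun I V => norm_integral_le_of_norm_le_prob fun W => hΦb _ _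
  have hterm' : ∀ I J, Integrable (fun V => χ I V * conj (χ J V) * Pk I J V) μ := fun I J =>
    integrable_of_norm_le (((hχm I).mul (hconj.comp (hχm J))).mul (hPm I J)) (K := K * K * K)
      fun V => by
        rw [norm_mul, norm_mul, Complex.norm_conj]
        exact mul_le_mul (mul_le_mul (hχb _ _) (hχb _ _) (norm_nonneg _) hK) (hPb _ _ _)
          (norm_nonneg _) (mul_nonneg hK hK)
  have hRHS : ∑ I, ∑ J, ∫ V, χ I V * conj (χ J V) * Pk I J V ∂μ =
      ∫ V, ∑ I, ∑ J, χ I V * conj (χ J V) * Pk I J V ∂μ := by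
    rw [integral_finsetSum _ fun I _ => integrable_finsetSum _ fun J _ => hterm' I J]
    exact Finset.sum_congr rfl fun I _ => (integral_finsetSum _ fun J _ => hterm' I J).symm
  rw [hLHS]
  simp_rw [hIJ]
  rw [hRHS]
  exact integral_nonneg fun V => hPpos V fun I => χ I V

/-- **Abstract lattice reflection positivity with a shared block and a positive kernel.**
Under the hypotheses of the core identity, let `g_I` (`I` in a finite set) and `aᵢ` (`i` in a
finite set) be bounded measurable functions depending only on `P ∪ C ∪ M`, and `Pk_{IJ}` a bounded
measurable kernel depending only on `M`, positive semidefinite at every configuration. Then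
`0 ≤ ∫∫ (Σ_{I,J} g_I(z) conj g_J(Θ U) Pk_{IJ}(U)) · exp(Σᵢ aᵢ(z) conj aᵢ(Θ U)) dμ(U) dμ(Y)`,
`z = splice C (U, Y)` (Gram expansion of the exponential, `integral_mul_mul_exp_sum_nonneg`, and
the kernel positivity lemma for each word). This is the form to which the reflection positivity
of lattice QCD with Wilson quarks reduces on the odd torus: `g_I` = coefficients of the
positive-time Grassmann integral, `Pk` = the Gaussian pairing kernel of the reflection slice,
`aᵢ` = the plaquettes and quark hoppings crossing the antipodal link plane. [cite: MontvayMunster1994, §4.2.3 (4.96) and (4.108)–(4.110)] [cite: OsterwalderSeiler1978, §2] -/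
theorem integral_sum_mul_conj_kernel_mul_exp_nonneg
    (hΘ : MeasurePreserving Θ (piMeasure μ₀) (piMeasure μ₀))
    (hΘM : ∀ U, ∀ i ∈ M, Θ U i = U i)
    (hΘdep : ∀ e ∈ P ∪ C, DependsOn (fun U => Θ U e) ((Pᶜ : Finset ι) : Set ι))
    (hMP : Disjoint M P) (hMC : Disjoint M C)
    {𝓘 : Type*} [Fintype 𝓘] {I₀ : Type*} [Fintype I₀]
    {g : 𝓘 → (ι → G) → ℂ} {Pk : 𝓘 → 𝓘 → (ι → G) → ℂ} {a : I₀ → (ι → G) → ℂ}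
    (hgm : ∀ I, Measurable (g I)) (hPm : ∀ I J, Measurable (Pk I J)) (ham : ∀ i, Measurable (a i))
    {K Ka : ℝ} (hgb : ∀ I U, ‖g I U‖ ≤ K) (hPb : ∀ I J U, ‖Pk I J U‖ ≤ K)
    (hab : ∀ i U, ‖a i U‖ ≤ Ka)
    (hgdep : ∀ I, DependsOn (g I) ((P ∪ C ∪ M : Finset ι) : Set ι))
    (hPdep : ∀ I J, DependsOn (Pk I J) ((M : Finset ι) : Set ι))
    (hadep : ∀ i, DependsOn (a i) ((P ∪ C ∪ M : Finset ι) : Set ι))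
    (hPpos : ∀ V (x : 𝓘 → ℂ), 0 ≤ ∑ I, ∑ J, x I * conj (x J) * Pk I J V) :
    0 ≤ ∫ q, (∑ I, ∑ J, g I (splice C q) * conj (g J (Θ q.1)) * Pk I J q.1) *
        Complex.exp (∑ i, a i (splice C q) * conj (a i (Θ q.1)))
      ∂((piMeasure μ₀).prod (piMeasure μ₀)) := by
  classical
  have hΘm : Measurable Θ := hΘ.measurable
  have hconj : Measurable (starRingEnd ℂ : ℂ → ℂ) := Complex.continuous_conj.measurable
  obtain ⟨U₀⟩ : Nonempty (ι → G) := by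
    have : Nonempty G := MeasureTheory.nonempty_of_isProbabilityMeasure μ₀
    infer_instance
  rcases isEmpty_or_nonempty 𝓘 with h𝓘 | ⟨⟨I₀⟩⟩
  · simp
  have hK : 0 ≤ K := (norm_nonneg _).trans (hgb I₀ U₀)
  -- `u = Σ g conj g Pk`, `v = 1`
  set u : (ι → G) × (ι → G) → ℂ := fun q =>
    ∑ I, ∑ J, g I (splice C q) * conj (g J (Θ q.1)) * Pk I J q.1 with hu
  have hum : Measurable u := Finset.measurable_sum _ fun I _ => Finset.measurable_sum _ fun J _ =>
    (((hgm I).comp (measurable_splice C)).mul (hconj.comp ((hgm J).comp (hΘm.comp measurable_fst)))).mul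
      ((hPm I J).comp measurable_fst)
  set Ku : ℝ := (Fintype.card 𝓘 : ℝ) * ((Fintype.card 𝓘 : ℝ) * (K * K * K)) + 1 with hKu
  have hub : ∀ q, ‖u q‖ ≤ Ku := fun q => by
    calc ‖u q‖ ≤ ∑ I, ‖∑ J, g I (splice C q) * conj (g J (Θ q.1)) * Pk I J q.1‖ := norm_sum_le _ _
      _ ≤ ∑ _I : 𝓘, (Fintype.card 𝓘 : ℝ) * (K * K * K) := Finset.sum_le_sum fun I _ => by
          calc ‖∑ J, g I (splice C q) * conj (g J (Θ q.1)) * Pk I J q.1‖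
              ≤ ∑ J, ‖g I (splice C q) * conj (g J (Θ q.1)) * Pk I J q.1‖ := norm_sum_le _ _
            _ ≤ ∑ _J : 𝓘, K * K * K := Finset.sum_le_sum fun J _ => by
                rw [norm_mul, norm_mul, Complex.norm_conj]
                exact mul_le_mul (mul_le_mul (hgb _ _) (hgb _ _) (norm_nonneg _) hK) (hPb _ _ _)
                  (norm_nonneg _) (mul_nonneg hK hK)
            _ = (Fintype.card 𝓘 : ℝ) * (K * K * K) := by
                rw [Finset.sum_const, Finset.card_univ, nsmul_eq_mul]
      _ = (Fintype.card 𝓘 : ℝ) * ((Fintype.card 𝓘 : ℝ) * (K * K * K)) := by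
          rw [Finset.sum_const, Finset.card_univ, nsmul_eq_mul]
      _ ≤ Ku := by rw [hKu]; linarith
  have h1b : ∀ q : (ι → G) × (ι → G), ‖(1 : ℂ)‖ ≤ Ku := fun q => by
    rw [norm_one, hKu]
    have : 0 ≤ (Fintype.card 𝓘 : ℝ) * ((Fintype.card 𝓘 : ℝ) * (K * K * K)) := by positivity
    linarith
  have key := integral_mul_mul_exp_sum_nonneg ((piMeasure μ₀).prod (piMeasure μ₀)) u (fun _ => 1)
    (fun i q => a i (splice C q)) (fun i q => conj (a i (Θ q.1))) hum measurable_const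
    (fun i => (ham i).comp (measurable_splice C))
    (fun i => hconj.comp ((ham i).comp (hΘm.comp measurable_fst)))
    (Ku := Ku) (Ka := Ka) hub h1b (fun i q => hab i _)
    (fun i q => by rw [Complex.norm_conj]; exact hab i _) fun n w => ?_
  · simpa only [mul_one] using key
  -- the word `w` gives the observables `Φ_I = g_I ∏ₜ a_{wₜ}`
  set Φ : 𝓘 → (ι → G) → ℂ := fun I U => g I U * ∏ t, a (w t) U with hΦ_def
  have hΦm : ∀ I, Measurable (Φ I) := fun I =>
    (hgm I).mul (Finset.measurable_prod _ fun t _ => ham (w t))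
  have hΦb : ∀ I U, ‖Φ I U‖ ≤ |K| * |Ka| ^ n + |K| := fun I U => by
    rw [hΦ_def, norm_mul]
    have h1 : ‖g I U‖ * ‖∏ t, a (w t) U‖ ≤ |K| * |Ka| ^ n := by
      refine mul_le_mul ((hgb I U).trans (le_abs_self _)) ?_ (norm_nonneg _) (abs_nonneg _)
      calc ‖∏ t, a (w t) U‖ = ∏ t, ‖a (w t) U‖ := norm_prod _ _
        _ ≤ ∏ _t : Fin n, |Ka| :=
            Finset.prod_le_prod (fun _ _ => norm_nonneg _) fun t _ => (hab _ _).trans (le_abs_self _)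
        _ = |Ka| ^ n := by simp
    linarith [abs_nonneg K]
  have hPb' : ∀ I J U, ‖Pk I J U‖ ≤ |K| * |Ka| ^ n + |K| := fun I J U =>
    ((hPb I J U).trans (le_abs_self _)).trans (le_add_of_nonneg_left (by positivity))
  have hΦdep : ∀ I, DependsOn (Φ I) ((P ∪ C ∪ M : Finset ι) : Set ι) := fun I U V hUV => by
    simp only [hΦ_def]
    rw [hgdep I hUV]
    congr 1
    exact Finset.prod_congr rfl fun t _ => hadep (w t) hUV
  have key := integral_sum_splice_mul_conj_kernel_nonneg μ₀ M P C Θ hΘ hΘM hΘdep hMP hMC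
    hΦm hPm hΦb hPb' hΦdep hPdep hPpos
  convert key using 2
  funext q
  simp only [hu, hΦ_def, map_mul, map_prod, one_mul, Finset.sum_mul]
  refine Finset.sum_congr rfl fun I _ => Finset.sum_congr rfl fun J _ => ?_
  ring

end

end Literature.MathematicalPhysics.QuantumFieldTheory.LatticeRP
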